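import Mathlib
import HarnessLib

/-!
# Route `KLProgramme` — crux C4a, S3 brick (B4) «(U1)-HYBRID» B-1 (ix): FEASIBILITY OF THE TANGENCY ROWS OF THE FIRST-ORDER LAYER — the two-node window `W`, the
# relative-angle window `Wϑ ≤ W`, and radii `ρ₁, τ₁` for the slice tube and the direct cut-off exist with every row of `directTangency_levelLine_abs_le'` satisfied

Cell `gate-hubbard-kl`, seat hubbard-kl-k3c3-p3 (g37; row «implicit-function / monotonicity route for μ(n)»).  Located brick for the (C)-closer lane / the `M₁`
assembly (stub (C) `stub_twoLeg_curvature` of `KLRegimeEngineV17F2`, stmt-HubbardSuperconductivity-20437), memo HOME/hubbard-kl-k3c3-p3/U1-CAUSTIC-SUP.md §20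
(«D2C-WINDOW-ROW» located and cured: the rows below are the primed, separate-window rows).

WHY.  `…C4aUmkDirectTangencyLine.directTangency_levelLine_abs_le'` / `…C4aFirstOrderLayerSum.firstOrderLayer_abs_le` carry four threshold rows in the window
`W`, the relative-angle window `Wϑ`, the offset `ρ` and the direct cut-off radius `τ₂`:  `W·C_w ≤ (3/200)u²` (curvature-floor window), `0 ≤ Wϑ ≤ W`,
`(|ρ|/2 + ρ²/(4c) + K_cτ₂/2)/κ < ((2u/π)Wϑ)²` (margin; `c = −μ − A − |ρ| ≥ c₀ > 0` on the tube) and `(π/(4u))(|ρ|/d + msD₁Wϑ + τ₂) ≤ W` (loop-angle localisation).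
They are jointly satisfiable, n-free: first `W`, then `Wϑ = W/(2(1 + (π/(4u))msD₁))`, then `ρ₁, τ₁` small against `W` and `T = κ((2u/π)Wϑ)²`.
* **`exists_tangencyWindows`** — carrier-free real arithmetic.
Pure arithmetic; nothing asserts (C), K3 or superconductivity.
References: BGM 2006 §2.4 [cite: BenfattoGiulianiMastropietro2006].
-/

noncomputable section

namespace Summit.HubbardSuperconductivity.HubbardSuperconductivity.Theorems.C4a

set_option linter.dupNamespace false -- summit = problem name (single-conjunct summit), D-0017

open Real Set

/-- **FEASIBILITY OF THE TANGENCY ROWS** (see the module docstring): for `u, κ, d, c₀ > 0` and `C_w, K_c, M ≥ 0` there are `W, Wϑ, ρ₁, τ₁ > 0` with `W·C_w ≤ (3/200)u²`,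
`Wϑ ≤ W`, and for all `|ρ| ≤ ρ₁`, `0 ≤ τ₂ ≤ τ₁`, `c ≥ c₀`: `(|ρ|/2 + ρ²/(4c) + K_cτ₂/2)/κ < ((2u/π)Wϑ)²` and `(π/(4u))(|ρ|/d + M·Wϑ + τ₂) ≤ W`. -/
theorem exists_tangencyWindows {u κ d c₀ Cw Kc M : ℝ} (hu : 0 < u) (hκ : 0 < κ) (hd : 0 < d) (hc₀ : 0 < c₀) (hCw : 0 ≤ Cw) (hKc : 0 ≤ Kc) (hM : 0 ≤ M) :
    ∃ W Wϑ ρ₁ τ₁ : ℝ, 0 < W ∧ W * Cw ≤ 3 / 200 * u ^ 2 ∧ 0 < Wϑ ∧ Wϑ ≤ W ∧ 0 < ρ₁ ∧ 0 < τ₁ ∧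
      ∀ ρ τ₂ c : ℝ, |ρ| ≤ ρ₁ → 0 ≤ τ₂ → τ₂ ≤ τ₁ → c₀ ≤ c →
        (|ρ| / 2 + ρ ^ 2 / (4 * c) + Kc * τ₂ / 2) / κ < (2 * u / π * Wϑ) ^ 2 ∧ π / (4 * u) * (|ρ| / d + M * Wϑ + τ₂) ≤ W := by
  have hπ := Real.pi_pos
  set k : ℝ := π / (4 * u) with hk
  have hk0 : 0 < k := by positivity
  -- the window
  set W : ℝ := min 1 (3 / 200 * u ^ 2 / (Cw + 1)) with hW
  have hW0 : 0 < W := lt_min one_pos (by positivity)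
  have hW1 : W ≤ 1 := min_le_left _ _
  have hWC : W * Cw ≤ 3 / 200 * u ^ 2 := by
    have h1 : W ≤ 3 / 200 * u ^ 2 / (Cw + 1) := min_le_right _ _
    calc W * Cw ≤ 3 / 200 * u ^ 2 / (Cw + 1) * Cw := mul_le_mul_of_nonneg_right h1 hCw
      _ ≤ 3 / 200 * u ^ 2 / (Cw + 1) * (Cw + 1) := mul_le_mul_of_nonneg_left (by linarith) (by positivity)
      _ = 3 / 200 * u ^ 2 := by field_simp
  -- the relative-angle window
  set Wϑ : ℝ := W / (2 * (k * M + 1)) with hWϑ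
  have hWϑ0 : 0 < Wϑ := by positivity
  have hWϑW : Wϑ ≤ W := by
    rw [hWϑ, div_le_iff₀ (by positivity)]; nlinarith [mul_nonneg hk0.le hM]
  have hkMW : k * (M * Wϑ) ≤ W / 2 := by
    have h : k * M * Wϑ = W / 2 * (k * M / (k * M + 1)) := by rw [hWϑ]; field_simp
    have h2 : k * M / (k * M + 1) ≤ 1 := (div_le_one (by positivity)).2 (by linarith)
    calc k * (M * Wϑ) = k * M * Wϑ := by ring
      _ = W / 2 * (k * M / (k * M + 1)) := h
      _ ≤ W / 2 * 1 := mul_le_mul_of_nonneg_left h2 (by positivity)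
      _ = W / 2 := mul_one _
  -- the margin target
  set T : ℝ := κ * (2 * u / π * Wϑ) ^ 2 with hT
  have hT0 : 0 < T := by positivity
  -- the radii
  set ρ₁ : ℝ := min (min (W * d / (4 * k)) 1) (min (T / 4) (T * c₀)) with hρ₁
  set τ₁ : ℝ := min (W / (4 * k)) (T / (4 * (Kc + 1))) with hτ₁
  have hρ₁0 : 0 < ρ₁ := lt_min (lt_min (by positivity) one_pos) (lt_min (by positivity) (by positivity))
  have hτ₁0 : 0 < τ₁ := lt_min (by positivity) (by positivity)
  refine ⟨W, Wϑ, ρ₁, τ₁, hW0, hWC, hWϑ0, hWϑW, hρ₁0, hτ₁0, fun ρ τ₂ c hρ hτ0 hτ hc => ⟨?_, ?_⟩⟩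
  · -- margin
    have hc0 : 0 < c := hc₀.trans_le hc
    have hρa : |ρ| ≤ T / 4 := hρ.trans ((min_le_right _ _).trans (min_le_left _ _))
    have hρb : |ρ| ≤ T * c₀ := hρ.trans ((min_le_right _ _).trans (min_le_right _ _))
    have hρc : |ρ| ≤ 1 := hρ.trans ((min_le_left _ _).trans (min_le_right _ _))
    have h1 : |ρ| / 2 ≤ T / 8 := by linarith
    have h2 : ρ ^ 2 / (4 * c) ≤ T / 4 := by
      rw [div_le_iff₀ (by positivity), ← sq_abs]
      have : |ρ| * |ρ| ≤ 1 * (T * c₀) := mul_le_mul hρc hρb (abs_nonneg _) zero_le_one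
      nlinarith [mul_le_mul_of_nonneg_left hc hT0.le]
    have h3 : Kc * τ₂ / 2 ≤ T / 8 := by
      have hτT : τ₂ ≤ T / (4 * (Kc + 1)) := hτ.trans (min_le_right _ _)
      have h4 : Kc * τ₂ ≤ Kc * (T / (4 * (Kc + 1))) := mul_le_mul_of_nonneg_left hτT hKc
      have h5 : Kc * (T / (4 * (Kc + 1))) = T / 4 * (Kc / (Kc + 1)) := by field_simp
      have h6 : Kc / (Kc + 1) ≤ 1 := (div_le_one (by positivity)).2 (by linarith)
      have h7 : T / 4 * (Kc / (Kc + 1)) ≤ T / 4 := by nlinarith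
      linarith
    have hsum : |ρ| / 2 + ρ ^ 2 / (4 * c) + Kc * τ₂ / 2 < T := by linarith
    rw [div_lt_iff₀ hκ]
    calc |ρ| / 2 + ρ ^ 2 / (4 * c) + Kc * τ₂ / 2 < T := hsum
      _ = (2 * u / π * Wϑ) ^ 2 * κ := by rw [hT]; ring
  · -- loop-angle localisation
    have hρW : |ρ| ≤ W * d / (4 * k) := hρ.trans ((min_le_left _ _).trans (min_le_left _ _))
    have hτW : τ₂ ≤ W / (4 * k) := hτ.trans (min_le_left _ _)
    have h1 : k * (|ρ| / d) ≤ W / 4 := by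
      have : |ρ| / d ≤ W / (4 * k) := by rw [div_le_iff₀ hd]; calc |ρ| ≤ W * d / (4 * k) := hρW
        _ = W / (4 * k) * d := by ring
      calc k * (|ρ| / d) ≤ k * (W / (4 * k)) := mul_le_mul_of_nonneg_left this hk0.le
        _ = W / 4 := by field_simp
    have h2 : k * τ₂ ≤ W / 4 := by
      calc k * τ₂ ≤ k * (W / (4 * k)) := mul_le_mul_of_nonneg_left hτW hk0.le
        _ = W / 4 := by field_simp
    calc π / (4 * u) * (|ρ| / d + M * Wϑ + τ₂) = k * (|ρ| / d) + k * (M * Wϑ) + k * τ₂ := by rw [hk]; ring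
      _ ≤ W / 4 + W / 2 + W / 4 := by linarith [hkMW]
      _ = W := by ring

end Summit.HubbardSuperconductivity.HubbardSuperconductivity.Theorems.C4a

end
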